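import Mathlib.Analysis.InnerProductSpace.Calculus
import Literature.Analysis.FluidPDE.TaoEnstrophyLocalisationProofs
import Literature.Analysis.FluidPDE.TaoEnstrophyContinuity
import Literature.Analysis.FluidPDE.SpaceTimeCalculus
import Literature.Analysis.FluidPDE.TaoEnergyLocalisation
import HarnessLib

/-!
# The enstrophy inequality under an `L^∞` bound (Serrin's criterion, endpoint `(2, ∞)`)

Analysis/FluidPDE proof file. For a classical solution `(u, p)` of the unforced Navier–Stokes
system on a closed slab `[0, T] × ℝ³` whose velocity, time derivative and pressure have the
`L²`-Sobolev regularity of Tao's smooth `H¹` theory (`u, ∂ₜu, p ∈ L^∞_t H^k_x`, Tao 2013,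
Thm. 5.4 (ii)+(iv): the class in which the local smooth solutions with controlled lifespan live)
and which is bounded, `|u| ≤ M` on `[0, s] × ℝ³`, the enstrophy obeys

`‖∇u(s)‖²_{L²} ≤ ‖∇u(0)‖²_{L²} · exp (M² s / (2ν))`

(`NS.lintegral_frobeniusNormSq_fderiv_le_mul_exp`). This is the case `(p, q) = (2, ∞)` of the
differential inequality behind Serrin's criterion as printed in Lemarié-Rieusset 2016, Thm. 11.2
and (11.9), (11.11): `d/dt ‖∇u‖²₂ ≤ C₀ ν^{1-p} ‖u‖_q^p ‖∇u‖²₂`, followed by Grönwall's lemma.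
It is the a-priori estimate that, combined with a local existence theorem whose lifespan is
controlled by `‖u₀‖_{H¹}` (Tao 2013, Thm. 5.4 (ii)), continues bounded classical solutions
(third assembly of `NS.hasSmoothExtensionPast_of_eLpNorm_three_bounded`, `NSCriticalClosure.lean`).

## The computation (Lemarié-Rieusset 2016, (11.9); here with the multiplier `∂ₜu`)

For interior times `t`, with `W = ∂ₜu(t)`, `v = u(t)`, `q = p(t)`:

1. `d/dt |∇u(t, x)|² = 2 Σᵢ ⟪∂ᵢv, ∂ᵢW⟫` pointwise (exchange of `∂ₜ` and `D`,
   `Fluid.IsSmoothSpaceTimeOn.hasDerivAt_fderiv_slice_timeDerivWithin`);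
2. `∫ Σᵢ ⟪∂ᵢv, ∂ᵢW⟫ = -∫ ⟪Δv, W⟫` (integration by parts on `ℝ³`, Mathlib
   `integral_bilinear_fderiv_right_eq_neg_left_of_integrable`, all products being `L¹` because
   `D v, D²v, W, DW ∈ L²`);
3. by the momentum equation `νΔv = W + (v·∇)v + ∇q`, so
   `-∫ ⟪Δv, W⟫ = -ν⁻¹ (‖W‖²₂ + ∫ ⟪(v·∇)v, W⟫ + ∫ ⟪∇q, W⟫)`;
4. `∫ ⟪∇q, W⟫ = -∫ q div W = 0`, since `div ∂ₜu = ∂ₜ div u = 0` (integration by parts again,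
   `q, ∇q ∈ L²`);
5. pointwise `|⟪(v·∇)v, W⟫| ≤ M |∇v| |W|`, hence `-(|W|² + ⟪(v·∇)v, W⟫) ≤ M²|∇v|²/4`, and
   `d/dt ‖∇u‖²₂ ≤ (M²/(2ν)) ‖∇u‖²₂`;
6. the identity `‖∇u(b)‖² - ‖∇u(a)‖² = ∫ₐᵇ (d/dt ‖∇u‖²)` (fundamental theorem of calculus in `t`
   for each `x`, then Fubini) and Grönwall's lemma in integral form
   (`NS.bootstrap_gronwall_integral`).

## Mathlib search

Integration by parts on the whole space: `integral_bilinear_fderiv_right_eq_neg_left_of_integrable`,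
`integral_mul_fderiv_eq_neg_fderiv_mul_of_integrable`; `HasDerivAt.norm_sq`;
`MeasureTheory.integral_integral_swap`; `intervalIntegral.integral_eq_sub_of_hasDerivAt_of_le`.
No Navier–Stokes material in Mathlib.

## References

* P. G. Lemarié-Rieusset, *The Navier–Stokes Problem in the 21st Century*, CRC Press (2016),
  §11.3, Thm. 11.2 with (11.9)–(11.11) (PDF pp. 338–339), and §7.1 Thm. 7.2.
* T. Tao, Anal. PDE 6 (2013) = arXiv:1108.1165, Thm. 5.4 (the regularity class).
-/

noncomputable section

open MeasureTheory Set Function Filter Topology InnerProductSpace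
open scoped ENNReal NNReal ContDiff RealInnerProductSpace Laplacian

namespace Literature.Analysis.FluidPDE

/-! ### Pointwise calculus on `ℝ³` -/

section Pointwise

variable {F : Type*} [NormedAddCommGroup F] [InnerProductSpace ℝ F] [FiniteDimensional ℝ F]

/-- Derivative of the Frobenius norm along a differentiable family of linear maps:
`d/dt |L(t)|² = 2 Σᵢ ⟪L(t) eᵢ, L'(t) eᵢ⟫`. [folklore] -/
theorem hasDerivAt_frobeniusNormSq {L : ℝ → EuclideanSpace ℝ (Fin 3) →L[ℝ] F}
    {L' : EuclideanSpace ℝ (Fin 3) →L[ℝ] F} {t : ℝ} (hL : HasDerivAt L L' t) :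
    HasDerivAt (fun s => FluidPDE.frobeniusNormSq (L s))
      (2 * ∑ i, ⟪L t (EuclideanSpace.basisFun (Fin 3) ℝ i),
        L' (EuclideanSpace.basisFun (Fin 3) ℝ i)⟫) t := by
  have hfun : (fun s => FluidPDE.frobeniusNormSq (L s)) =
      fun s => ∑ i, ‖L s (EuclideanSpace.basisFun (Fin 3) ℝ i)‖ ^ 2 := by
    funext s
    exact FluidPDE.frobeniusNormSq_eq_sum (EuclideanSpace.basisFun (Fin 3) ℝ) (L s)
  rw [hfun, Finset.mul_sum]
  refine HasDerivAt.fun_sum fun i _ => ?_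
  have h1 : HasDerivAt (fun s => L s (EuclideanSpace.basisFun (Fin 3) ℝ i))
      (L' (EuclideanSpace.basisFun (Fin 3) ℝ i)) t := by
    simpa using hL.clm_apply (hasDerivAt_const t (EuclideanSpace.basisFun (Fin 3) ℝ i))
  exact h1.norm_sq

/-- `‖Dv(x) e‖ ≤ ‖D¹v(x)‖` for a unit vector `e` of the standard basis. [folklore] -/
theorem norm_fderiv_apply_basisFun_le {G : Type*} [NormedAddCommGroup G] [NormedSpace ℝ G]
    (v : EuclideanSpace ℝ (Fin 3) → G) (x : EuclideanSpace ℝ (Fin 3)) (i : Fin 3) :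
    ‖fderiv ℝ v x (EuclideanSpace.basisFun (Fin 3) ℝ i)‖ ≤ ‖iteratedFDeriv ℝ 1 v x‖ := by
  rw [← norm_iteratedFDeriv_fderiv, norm_iteratedFDeriv_zero]
  simpa using (fderiv ℝ v x).le_opNorm (EuclideanSpace.basisFun (Fin 3) ℝ i)

omit [FiniteDimensional ℝ F] in
/-- `‖∂ᵢ∂ᵢ v(x)‖ ≤ ‖D²v(x)‖` for the standard basis vectors. [folklore] -/
theorem norm_fderiv_fderiv_apply_basisFun_le {v : EuclideanSpace ℝ (Fin 3) → F}
    (hv : ContDiff ℝ 2 v)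
    (x : EuclideanSpace ℝ (Fin 3)) (i : Fin 3) :
    ‖fderiv ℝ (fun y => fderiv ℝ v y (EuclideanSpace.basisFun (Fin 3) ℝ i)) x
        (EuclideanSpace.basisFun (Fin 3) ℝ i)‖ ≤ ‖iteratedFDeriv ℝ 2 v x‖ := by
  rw [FluidPDE.fderiv_fderiv_apply_const hv]
  refine (ContinuousMultilinearMap.le_opNorm _ _).trans ?_
  have : ∏ j : Fin 2, ‖(![EuclideanSpace.basisFun (Fin 3) ℝ i,
      EuclideanSpace.basisFun (Fin 3) ℝ i] : Fin 2 → EuclideanSpace ℝ (Fin 3)) j‖ = 1 := by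
    simp [Fin.prod_univ_two]
  rw [this, mul_one]

/-- The Frobenius norm is at most `3` times the squared operator norm on `ℝ³`. [folklore] -/
theorem frobeniusNormSq_le_three_mul (L : EuclideanSpace ℝ (Fin 3) →L[ℝ] F) :
    FluidPDE.frobeniusNormSq L ≤ 3 * ‖L‖ ^ 2 := by
  rw [FluidPDE.frobeniusNormSq_eq_sum (EuclideanSpace.basisFun (Fin 3) ℝ)]
  simpa using FluidPDE.sum_sq_norm_apply_le_card_mul_sq_opNorm (EuclideanSpace.basisFun (Fin 3) ℝ) L

/-- `⟪∇q(x), w⟫ = Σᵢ ⟪eᵢ, w⟫ ∂ᵢq(x)` in the standard basis. [folklore] -/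
theorem inner_gradient_eq_sum_basisFun (q : EuclideanSpace ℝ (Fin 3) → ℝ) (x w : EuclideanSpace ℝ (Fin 3)) :
    ⟪gradient q x, w⟫ = ∑ i, ⟪EuclideanSpace.basisFun (Fin 3) ℝ i, w⟫ *
      fderiv ℝ q x (EuclideanSpace.basisFun (Fin 3) ℝ i) := by
  rw [gradient, InnerProductSpace.toDual_symm_apply]
  conv_lhs => rw [← (EuclideanSpace.basisFun (Fin 3) ℝ).sum_repr' w]
  simp [map_sum, map_smul]

omit [FiniteDimensional ℝ F] in
/-- `D(x ↦ ⟪c, w x⟫)(x) a = ⟪c, Dw(x) a⟫` for a `C¹` field `w`. [folklore] -/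
theorem fderiv_inner_const_left_apply_of_contDiff {w : EuclideanSpace ℝ (Fin 3) → F} (hw : ContDiff ℝ 1 w)
    (c : F) (x a : EuclideanSpace ℝ (Fin 3)) :
    fderiv ℝ (fun y => ⟪c, w y⟫) x a = ⟪c, fderiv ℝ w x a⟫ := by
  have h : HasFDerivAt (fun y => ⟪c, w y⟫) ((innerSL ℝ c).comp (fderiv ℝ w x)) x :=
    (innerSL ℝ c).hasFDerivAt.comp x ((hw.differentiable one_ne_zero) x).hasFDerivAt
  rw [h.fderiv]
  simp

/-- The divergence of the time derivative of a divergence-free jointly smooth field vanishes at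
interior times: `div ∂ₜu = ∂ₜ div u = 0`. [folklore] -/
theorem isDivFree_timeDerivWithin {T : ℝ}
    {u : ℝ → EuclideanSpace ℝ (Fin 3) → EuclideanSpace ℝ (Fin 3)}
    (hu : FluidPDE.IsSmoothSpaceTimeOn (Icc 0 T) u) (hdiv : ∀ t ∈ Icc 0 T, VectorCalculus.IsDivFree (u t))
    {t : ℝ} (ht : t ∈ Ioo 0 T) : VectorCalculus.IsDivFree (FluidPDE.timeDerivWithin (Icc 0 T) u t) := by
  intro x
  have hD := hu.hasDerivAt_fderiv_slice_timeDerivWithin isOpen_Ioo Ioo_subset_Icc_self ht x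
  -- apply the trace
  have htr : HasDerivAt (fun s => FluidPDE.traceCLM (fderiv ℝ (u s) x))
      (FluidPDE.traceCLM (fderiv ℝ (FluidPDE.timeDerivWithin (Icc 0 T) u t) x)) t :=
    (FluidPDE.traceCLM (E := EuclideanSpace ℝ (Fin 3))).hasFDerivAt.comp_hasDerivAt t hD
  -- the divergence of `u s` vanishes near `t`
  have hzero : HasDerivAt (fun s => FluidPDE.traceCLM (fderiv ℝ (u s) x)) 0 t := by
    refine (hasDerivAt_const t (0 : ℝ)).congr_of_eventuallyEq ?_
    filter_upwards [isOpen_Ioo.mem_nhds ht] with s hs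
    exact hdiv s (Ioo_subset_Icc_self hs) x
  rw [FluidPDE.divergence_eq_traceCLM]
  exact htr.unique hzero

end Pointwise

/-! ### Integrability of products of continuous square-integrable fields -/

section Integrable

variable {G G₁ G₂ : Type*} [NormedAddCommGroup G] [NormedAddCommGroup G₁] [NormedAddCommGroup G₂]

/-- A measurable field dominated by the product of two continuous square-integrable fields is
integrable (`|φ| ≤ |a| |b| ≤ (|a|² + |b|²)/2`). [folklore] -/
theorem integrable_of_norm_le_mul_of_lintegral_sq {φ : EuclideanSpace ℝ (Fin 3) → G}
    {a : EuclideanSpace ℝ (Fin 3) → G₁} {b : EuclideanSpace ℝ (Fin 3) → G₂}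
    (hφ : AEStronglyMeasurable φ volume) (ha : Continuous a) (hb : Continuous b)
    (ha2 : ∫⁻ x, ‖a x‖ₑ ^ 2 < ⊤) (hb2 : ∫⁻ x, ‖b x‖ₑ ^ 2 < ⊤)
    (hle : ∀ x, ‖φ x‖ ≤ ‖a x‖ * ‖b x‖) : Integrable φ volume := by
  have hia := FluidPDE.integrable_sq_norm_of_lintegral_lt_top ha ha2
  have hib := FluidPDE.integrable_sq_norm_of_lintegral_lt_top hb hb2
  refine Integrable.mono' ((hia.add hib).div_const 2) hφ (Eventually.of_forall fun x => ?_)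
  calc ‖φ x‖ ≤ ‖a x‖ * ‖b x‖ := hle x
    _ ≤ (‖a x‖ ^ 2 + ‖b x‖ ^ 2) / 2 := by nlinarith [sq_nonneg (‖a x‖ - ‖b x‖)]
    _ = ((fun x => ‖a x‖ ^ 2) + fun x => ‖b x‖ ^ 2) x / 2 := rfl

end Integrable

/-! ### Two integrations by parts on `ℝ³` -/

section IBP

/-- **`∫ ⟪∇v, ∇w⟫ = -∫ ⟪Δv, w⟫` on `ℝ³`** for `v ∈ C²`, `w ∈ C¹` with `∂ᵢ∂ᵢv · w`, `∂ᵢv · ∂ᵢw`,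
`∂ᵢv · w ∈ L¹` (coordinatewise integration by parts, Mathlib
`integral_bilinear_fderiv_right_eq_neg_left_of_integrable`, and `Δv = Σᵢ ∂ᵢ∂ᵢv`). [folklore] -/
theorem integral_sum_inner_fderiv_fderiv_eq_neg_integral_inner_laplacian
    {v w : EuclideanSpace ℝ (Fin 3) → EuclideanSpace ℝ (Fin 3)} (hv : ContDiff ℝ 2 v)
    (hw : ContDiff ℝ 1 w)
    (h1 : ∀ i, Integrable (fun x => ⟪fderiv ℝ (fun y => fderiv ℝ v y
      (EuclideanSpace.basisFun (Fin 3) ℝ i)) x (EuclideanSpace.basisFun (Fin 3) ℝ i), w x⟫) volume)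
    (h2 : ∀ i, Integrable (fun x => ⟪fderiv ℝ v x (EuclideanSpace.basisFun (Fin 3) ℝ i),
      fderiv ℝ w x (EuclideanSpace.basisFun (Fin 3) ℝ i)⟫) volume)
    (h3 : ∀ i, Integrable (fun x => ⟪fderiv ℝ v x (EuclideanSpace.basisFun (Fin 3) ℝ i), w x⟫)
      volume) :
    ∫ x, ∑ i, ⟪fderiv ℝ v x (EuclideanSpace.basisFun (Fin 3) ℝ i),
        fderiv ℝ w x (EuclideanSpace.basisFun (Fin 3) ℝ i)⟫ =
      - ∫ x, ⟪(Δ v) x, w x⟫ := by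
  set e := EuclideanSpace.basisFun (Fin 3) ℝ with he
  have hdf : ∀ i, Differentiable ℝ (fun y => fderiv ℝ v y (e i)) := fun i =>
    ((hv.fderiv_right (m := 1) le_rfl).clm_apply contDiff_const).differentiable one_ne_zero
  have hdw : Differentiable ℝ w := hw.differentiable one_ne_zero
  -- coordinatewise integration by parts
  have hIBP : ∀ i, ∫ x, ⟪fderiv ℝ v x (e i), fderiv ℝ w x (e i)⟫ =
      - ∫ x, ⟪fderiv ℝ (fun y => fderiv ℝ v y (e i)) x (e i), w x⟫ := by
    intro i
    have := integral_bilinear_fderiv_right_eq_neg_left_of_integrable (μ := volume)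
      (B := (innerSL ℝ : EuclideanSpace ℝ (Fin 3) →L[ℝ] EuclideanSpace ℝ (Fin 3) →L[ℝ] ℝ))
      (f := fun y => fderiv ℝ v y (e i)) (g := w) (v := e i) (by exact h1 i) (by exact h2 i)
      (by exact h3 i) (fun x _ => hdf i x) (fun x _ => hdw x)
    exact this
  rw [integral_finsetSum _ fun i _ => h2 i]
  simp_rw [hIBP]
  rw [Finset.sum_neg_distrib, ← integral_finsetSum _ fun i _ => h1 i]
  congr 1
  refine integral_congr_ae (Eventually.of_forall fun x => ?_)
  simp only
  rw [FluidPDE.laplacian_eq_sum_fderiv_fderiv e hv x, sum_inner]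

/-- **`∫ ⟪∇q, w⟫ = 0` for a divergence-free field**: `∫ ⟪∇q, w⟫ = Σᵢ ∫ wᵢ ∂ᵢq = -∫ q div w = 0`
for `q, w ∈ C¹` with `wᵢ ∂ᵢq`, `∂ᵢwᵢ q`, `wᵢ q ∈ L¹` (Mathlib
`integral_mul_fderiv_eq_neg_fderiv_mul_of_integrable`). [folklore] -/
theorem integral_inner_gradient_eq_zero_of_isDivFree_R3 {q : EuclideanSpace ℝ (Fin 3) → ℝ}
    {w : EuclideanSpace ℝ (Fin 3) → EuclideanSpace ℝ (Fin 3)} (hq : ContDiff ℝ 1 q)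
    (hw : ContDiff ℝ 1 w) (hdiv : VectorCalculus.IsDivFree w)
    (h1 : ∀ i, Integrable (fun x => ⟪EuclideanSpace.basisFun (Fin 3) ℝ i, w x⟫ *
      fderiv ℝ q x (EuclideanSpace.basisFun (Fin 3) ℝ i)) volume)
    (h2 : ∀ i, Integrable (fun x => ⟪EuclideanSpace.basisFun (Fin 3) ℝ i,
      fderiv ℝ w x (EuclideanSpace.basisFun (Fin 3) ℝ i)⟫ * q x) volume)
    (h3 : ∀ i, Integrable (fun x => ⟪EuclideanSpace.basisFun (Fin 3) ℝ i, w x⟫ * q x) volume) :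
    ∫ x, ⟪gradient q x, w x⟫ = 0 := by
  set e := EuclideanSpace.basisFun (Fin 3) ℝ with he
  have hdq : Differentiable ℝ q := hq.differentiable one_ne_zero
  have hdwi : ∀ i, Differentiable ℝ (fun y => ⟪e i, w y⟫) := fun i =>
    ((innerSL ℝ (e i)).differentiable).comp (hw.differentiable one_ne_zero)
  have hderiv : ∀ i x, fderiv ℝ (fun y => ⟪e i, w y⟫) x (e i) = ⟪e i, fderiv ℝ w x (e i)⟫ :=
    fun i x => fderiv_inner_const_left_apply_of_contDiff hw (e i) x (e i)
  -- coordinatewise integration by parts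
  have hIBP : ∀ i, ∫ x, ⟪e i, w x⟫ * fderiv ℝ q x (e i) =
      - ∫ x, ⟪e i, fderiv ℝ w x (e i)⟫ * q x := by
    intro i
    have h2' : Integrable (fun x => fderiv ℝ (fun y => ⟪e i, w y⟫) x (e i) * q x) volume := by
      simp_rw [hderiv]; exact h2 i
    have := integral_mul_fderiv_eq_neg_fderiv_mul_of_integrable (μ := volume)
      (f := fun y => ⟪e i, w y⟫) (g := q) (v := e i) h2' (h1 i) (h3 i)
      (fun x _ => hdwi i x) (fun x _ => hdq x)
    rw [this]
    simp_rw [hderiv]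
  have hsum : (fun x => ⟪gradient q x, w x⟫) = fun x => ∑ i, ⟪e i, w x⟫ * fderiv ℝ q x (e i) :=
    funext fun x => inner_gradient_eq_sum_basisFun q x (w x)
  rw [hsum, integral_finsetSum _ fun i _ => h1 i]
  simp_rw [hIBP]
  rw [Finset.sum_neg_distrib, ← integral_finsetSum _ fun i _ => h2 i, neg_eq_zero]
  refine integral_eq_zero_of_ae (Eventually.of_forall fun x => ?_)
  simp only [Pi.zero_apply]
  rw [← Finset.sum_mul, ← FluidPDE.divergence_eq_sum_inner_fderiv e w x, hdiv x, zero_mul]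

end IBP

/-! ### Finite `L²` norms: transfer along pointwise bounds -/

section L2

variable {G₁ G₂ : Type*} [NormedAddCommGroup G₁] [NormedAddCommGroup G₂]

/-- `∫ ‖a‖² < ∞` from `‖a‖ ≤ ‖b‖` pointwise and `∫ ‖b‖² < ∞`. [folklore] -/
theorem lintegral_enorm_sq_lt_top_of_norm_le {α : Type*} [MeasurableSpace α] {μ : Measure α}
    {a : α → G₁} {b : α → G₂} (h : ∀ x, ‖a x‖ ≤ ‖b x‖) (hb : ∫⁻ x, ‖b x‖ₑ ^ 2 ∂μ < ⊤) :
    ∫⁻ x, ‖a x‖ₑ ^ 2 ∂μ < ⊤ := by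
  refine lt_of_le_of_lt (lintegral_mono fun x => ?_) hb
  have hx : ‖a x‖ₑ ≤ ‖b x‖ₑ := by
    rw [← ofReal_norm, ← ofReal_norm]
    exact ENNReal.ofReal_le_ofReal (h x)
  gcongr

/-- `‖Dv(x)‖ₑ² ≤ ofReal |∇v(x)|²` (operator norm versus Frobenius norm). [folklore] -/
theorem enorm_sq_fderiv_le_ofReal_frobeniusNormSq {F : Type*} [NormedAddCommGroup F]
    [InnerProductSpace ℝ F] (L : EuclideanSpace ℝ (Fin 3) →L[ℝ] F) :
    ‖L‖ₑ ^ 2 ≤ ENNReal.ofReal (FluidPDE.frobeniusNormSq L) := by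
  rw [← ofReal_norm, ← ENNReal.ofReal_pow (norm_nonneg _)]
  exact ENNReal.ofReal_le_ofReal (FluidPDE.sq_opNorm_le_frobeniusNormSq L)

/-- `∫ ‖Dv‖² < ∞` from `∫ |∇v|² < ∞`. [folklore] -/
theorem lintegral_enorm_sq_fderiv_lt_top {F : Type*} [NormedAddCommGroup F]
    [InnerProductSpace ℝ F] {v : EuclideanSpace ℝ (Fin 3) → F}
    (hv : ∫⁻ x, ENNReal.ofReal (FluidPDE.frobeniusNormSq (fderiv ℝ v x)) < ⊤) :
    ∫⁻ x, ‖fderiv ℝ v x‖ₑ ^ 2 < ⊤ :=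
  lt_of_le_of_lt (lintegral_mono fun _ => enorm_sq_fderiv_le_ofReal_frobeniusNormSq _) hv

/-- A continuous nonnegative function with finite lower integral is integrable. [folklore] -/
theorem integrable_of_continuous_of_nonneg {g : EuclideanSpace ℝ (Fin 3) → ℝ} (hg : Continuous g)
    (h0 : ∀ x, 0 ≤ g x) (hfin : ∫⁻ x, ENNReal.ofReal (g x) < ⊤) : Integrable g volume := by
  refine ⟨hg.aestronglyMeasurable, ?_⟩
  rw [HasFiniteIntegral]
  refine lt_of_le_of_lt (le_of_eq (lintegral_congr fun x => ?_)) hfin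
  exact Real.enorm_eq_ofReal (h0 x)

end L2

/-! ### The enstrophy production at a fixed time -/

section Slice

/-- **The enstrophy production bound at a fixed time** (Lemarié-Rieusset 2016, (11.9) and the
first display of the proof of Thm. 11.2, case `q = ∞`). Let `v, W : ℝ³ → ℝ³` (`C²` resp. `C¹`)
and `q : ℝ³ → ℝ` (`C¹`) satisfy the momentum equation `W + (v·∇)v = νΔv - ∇q` with `div W = 0`
(so `W = ∂ₜu`, `v = u(t)`, `q = p(t)` for a classical solution), `|v| ≤ M`, and
`∇v, D²v, W, DW, q, Dq ∈ L²`. Then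
`∫ Σᵢ ⟪∂ᵢv, ∂ᵢW⟫ ≤ (M²/(4ν)) ∫ |∇v|²`.
Proof: `∫ Σᵢ ⟪∂ᵢv, ∂ᵢW⟫ = -∫ ⟪Δv, W⟫ = -ν⁻¹ ∫ (|W|² + ⟪(v·∇)v, W⟫ + ⟪∇q, W⟫)`, the pressure
term integrates to zero against the divergence-free `W`, and pointwise
`-(|W|² + ⟪(v·∇)v, W⟫) ≤ -|W|² + M|∇v||W| ≤ M²|∇v|²/4`. [cite: LemarieRieusset2016, Thm. 11.2 with (11.9)] -/
theorem integral_sum_inner_fderiv_le_of_momentum {ν : ℝ} (hν : 0 < ν)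
    {v W : EuclideanSpace ℝ (Fin 3) → EuclideanSpace ℝ (Fin 3)} {q : EuclideanSpace ℝ (Fin 3) → ℝ}
    (hv : ContDiff ℝ 2 v) (hW : ContDiff ℝ 1 W) (hq : ContDiff ℝ 1 q)
    (hmom : ∀ x, W x + FluidPDE.convect v v x = ν • (Δ v) x - gradient q x)
    (hdivW : VectorCalculus.IsDivFree W) {M : ℝ} (hM0 : 0 ≤ M) (hM : ∀ x, ‖v x‖ ≤ M)
    (hv1 : ∫⁻ x, ENNReal.ofReal (FluidPDE.frobeniusNormSq (fderiv ℝ v x)) < ⊤)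
    (hv2 : ∫⁻ x, ‖iteratedFDeriv ℝ 2 v x‖ₑ ^ 2 < ⊤)
    (hW0 : ∫⁻ x, ‖W x‖ₑ ^ 2 < ⊤) (hW1 : ∫⁻ x, ‖iteratedFDeriv ℝ 1 W x‖ₑ ^ 2 < ⊤)
    (hq0 : ∫⁻ x, ‖q x‖ₑ ^ 2 < ⊤) (hq1 : ∫⁻ x, ‖iteratedFDeriv ℝ 1 q x‖ₑ ^ 2 < ⊤) :
    ∫ x, ∑ i, ⟪fderiv ℝ v x (EuclideanSpace.basisFun (Fin 3) ℝ i),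
        fderiv ℝ W x (EuclideanSpace.basisFun (Fin 3) ℝ i)⟫ ≤
      M ^ 2 / (4 * ν) * ∫ x, FluidPDE.frobeniusNormSq (fderiv ℝ v x) := by
  set e := EuclideanSpace.basisFun (Fin 3) ℝ with he
  have he1 : ∀ i, ‖e i‖ = 1 := fun i => by simp [he]
  -- continuity of all the fields involved
  have cv : Continuous v := hv.continuous
  have cDv : Continuous (fderiv ℝ v) := hv.continuous_fderiv two_ne_zero
  have cdiv : ∀ i, Continuous fun x => fderiv ℝ v x (e i) := fun i => cDv.clm_apply continuous_const
  have cddv : ∀ i, Continuous fun x => fderiv ℝ (fun y => fderiv ℝ v y (e i)) x (e i) := fun i =>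
    ((((hv.fderiv_right (m := 1) le_rfl).clm_apply contDiff_const).continuous_fderiv
      one_ne_zero).clm_apply continuous_const)
  have cW : Continuous W := hW.continuous
  have cDW : Continuous (fderiv ℝ W) := hW.continuous_fderiv one_ne_zero
  have cdiW : ∀ i, Continuous fun x => fderiv ℝ W x (e i) := fun i => cDW.clm_apply continuous_const
  have cq : Continuous q := hq.continuous
  have cDq : Continuous (fderiv ℝ q) := hq.continuous_fderiv one_ne_zero
  have cdiq : ∀ i, Continuous fun x => fderiv ℝ q x (e i) := fun i => cDq.clm_apply continuous_const
  have cgq : Continuous (gradient q) := by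
    have : gradient q = fun x => (InnerProductSpace.toDual ℝ _).symm (fderiv ℝ q x) := rfl
    rw [this]
    exact (InnerProductSpace.toDual ℝ (EuclideanSpace ℝ (Fin 3))).symm.continuous.comp cDq
  have cconv : Continuous (FluidPDE.convect v v) := cDv.clm_apply cv
  have cfrob : Continuous fun x => FluidPDE.frobeniusNormSq (fderiv ℝ v x) :=
    FluidPDE.continuous_frobeniusNormSq_fderiv hv two_ne_zero
  -- finite `L²` norms of the derived fields
  have l2Dv : ∫⁻ x, ‖fderiv ℝ v x‖ₑ ^ 2 < ⊤ := lintegral_enorm_sq_fderiv_lt_top hv1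
  have l2div : ∀ i, ∫⁻ x, ‖fderiv ℝ v x (e i)‖ₑ ^ 2 < ⊤ := fun i =>
    lintegral_enorm_sq_lt_top_of_norm_le (fun x => by
      simpa [he1] using (fderiv ℝ v x).le_opNorm (e i)) l2Dv
  have l2ddv : ∀ i, ∫⁻ x, ‖fderiv ℝ (fun y => fderiv ℝ v y (e i)) x (e i)‖ₑ ^ 2 < ⊤ := fun i =>
    lintegral_enorm_sq_lt_top_of_norm_le (fun x => norm_fderiv_fderiv_apply_basisFun_le hv x i) hv2
  have l2diW : ∀ i, ∫⁻ x, ‖fderiv ℝ W x (e i)‖ₑ ^ 2 < ⊤ := fun i =>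
    lintegral_enorm_sq_lt_top_of_norm_le (fun x => norm_fderiv_apply_basisFun_le W x i) hW1
  have l2diq : ∀ i, ∫⁻ x, ‖fderiv ℝ q x (e i)‖ₑ ^ 2 < ⊤ := fun i =>
    lintegral_enorm_sq_lt_top_of_norm_le (fun x => norm_fderiv_apply_basisFun_le q x i) hq1
  have l2gq : ∫⁻ x, ‖gradient q x‖ₑ ^ 2 < ⊤ := by
    refine lintegral_enorm_sq_lt_top_of_norm_le (fun x => ?_) hq1
    rw [gradient, LinearIsometryEquiv.norm_map, ← norm_iteratedFDeriv_fderiv, norm_iteratedFDeriv_zero]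
  have l2conv : ∫⁻ x, ‖FluidPDE.convect v v x‖ₑ ^ 2 < ⊤ := by
    refine lintegral_enorm_sq_lt_top_of_norm_le (b := fun x => M • fderiv ℝ v x) (fun x => ?_) ?_
    · rw [FluidPDE.convect, norm_smul, Real.norm_of_nonneg hM0, mul_comm]
      exact (fderiv ℝ v x).le_opNorm_of_le (hM x)
    · have : ∀ x, ‖M • fderiv ℝ v x‖ₑ ^ 2 = ENNReal.ofReal (M ^ 2) * ‖fderiv ℝ v x‖ₑ ^ 2 := by
        intro x
        rw [enorm_smul, mul_pow, Real.enorm_eq_ofReal hM0, ENNReal.ofReal_pow hM0]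
      simp_rw [this]
      rw [lintegral_const_mul' _ _ ENNReal.ofReal_ne_top]
      exact ENNReal.mul_lt_top ENNReal.ofReal_lt_top l2Dv
  -- integrability of the products
  have i1 : ∀ i, Integrable (fun x => ⟪fderiv ℝ (fun y => fderiv ℝ v y (e i)) x (e i), W x⟫)
      volume := fun i =>
    integrable_of_norm_le_mul_of_lintegral_sq ((cddv i).inner cW).aestronglyMeasurable (cddv i) cW
      (l2ddv i) hW0 fun x => norm_inner_le_norm _ _
  have i2 : ∀ i, Integrable (fun x => ⟪fderiv ℝ v x (e i), fderiv ℝ W x (e i)⟫) volume := fun i =>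
    integrable_of_norm_le_mul_of_lintegral_sq ((cdiv i).inner (cdiW i)).aestronglyMeasurable
      (cdiv i) (cdiW i) (l2div i) (l2diW i) fun x => norm_inner_le_norm _ _
  have i3 : ∀ i, Integrable (fun x => ⟪fderiv ℝ v x (e i), W x⟫) volume := fun i =>
    integrable_of_norm_le_mul_of_lintegral_sq ((cdiv i).inner cW).aestronglyMeasurable (cdiv i) cW
      (l2div i) hW0 fun x => norm_inner_le_norm _ _
  have iLap : Integrable (fun x => ⟪(Δ v) x, W x⟫) volume := by
    refine (integrable_finsetSum Finset.univ fun i _ => i1 i).congr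
      (Eventually.of_forall fun x => ?_)
    dsimp only
    rw [FluidPDE.laplacian_eq_sum_fderiv_fderiv e hv x, sum_inner]
  have iWW : Integrable (fun x => ‖W x‖ ^ 2) volume := FluidPDE.integrable_sq_norm_of_lintegral_lt_top cW hW0
  have iconv : Integrable (fun x => ⟪FluidPDE.convect v v x, W x⟫) volume :=
    integrable_of_norm_le_mul_of_lintegral_sq (cconv.inner cW).aestronglyMeasurable cconv cW
      l2conv hW0 fun x => norm_inner_le_norm _ _
  have igW : Integrable (fun x => ⟪gradient q x, W x⟫) volume :=
    integrable_of_norm_le_mul_of_lintegral_sq (cgq.inner cW).aestronglyMeasurable cgq cW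
      l2gq hW0 fun x => norm_inner_le_norm _ _
  have ifrob : Integrable (fun x => FluidPDE.frobeniusNormSq (fderiv ℝ v x)) volume :=
    integrable_of_continuous_of_nonneg cfrob (fun x => FluidPDE.frobeniusNormSq_nonneg _) hv1
  -- the pressure term vanishes
  have hin : ∀ i (y : EuclideanSpace ℝ (Fin 3)), ‖⟪e i, y⟫‖ ≤ ‖y‖ := fun i y =>
    (norm_inner_le_norm (𝕜 := ℝ) (e i) y).trans (by rw [he1, one_mul])
  have hpress : ∫ x, ⟪gradient q x, W x⟫ = 0 := by
    refine integral_inner_gradient_eq_zero_of_isDivFree_R3 hq hW hdivW (fun i => ?_) (fun i => ?_)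
      (fun i => ?_)
    · refine integrable_of_norm_le_mul_of_lintegral_sq
        ((continuous_const.inner cW).mul (cdiq i)).aestronglyMeasurable cW (cdiq i) hW0 (l2diq i)
        fun x => ?_
      rw [norm_mul]
      exact mul_le_mul_of_nonneg_right (hin i (W x)) (norm_nonneg _)
    · refine integrable_of_norm_le_mul_of_lintegral_sq
        ((continuous_const.inner (cdiW i)).mul cq).aestronglyMeasurable (cdiW i) cq (l2diW i) hq0
        fun x => ?_
      rw [norm_mul]
      exact mul_le_mul_of_nonneg_right (hin i (fderiv ℝ W x (e i))) (norm_nonneg _)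
    · refine integrable_of_norm_le_mul_of_lintegral_sq
        ((continuous_const.inner cW).mul cq).aestronglyMeasurable cW cq hW0 hq0
        fun x => ?_
      rw [norm_mul]
      exact mul_le_mul_of_nonneg_right (hin i (W x)) (norm_nonneg _)
  -- pointwise: the momentum equation and the absorption
  have hpt : ∀ x, -⟪(Δ v) x, W x⟫ ≤
      M ^ 2 / (4 * ν) * FluidPDE.frobeniusNormSq (fderiv ℝ v x) - ν⁻¹ * ⟪gradient q x, W x⟫ := by
    intro x
    have hΔ : (Δ v) x = ν⁻¹ • (W x + FluidPDE.convect v v x + gradient q x) := by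
      have h := hmom x
      rw [eq_sub_iff_add_eq] at h
      rw [h, smul_smul, inv_mul_cancel₀ hν.ne', one_smul]
    rw [hΔ, inner_smul_left, inner_add_left, inner_add_left, real_inner_self_eq_norm_sq]
    simp only [conj_trivial]
    -- `|⟪(v·∇)v, W⟫| ≤ M ‖Dv‖ ‖W‖` and `‖Dv‖² ≤ |∇v|²`
    have hc : |⟪FluidPDE.convect v v x, W x⟫| ≤ M * ‖fderiv ℝ v x‖ * ‖W x‖ := by
      refine (abs_real_inner_le_norm _ _).trans ?_
      gcongr
      rw [FluidPDE.convect, mul_comm]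
      exact (fderiv ℝ v x).le_opNorm_of_le (hM x)
    have hk : (M * ‖fderiv ℝ v x‖) ^ 2 ≤ M ^ 2 * FluidPDE.frobeniusNormSq (fderiv ℝ v x) := by
      rw [mul_pow]
      gcongr
      exact FluidPDE.sq_opNorm_le_frobeniusNormSq _
    have hν' : 0 < ν⁻¹ := inv_pos.2 hν
    have key : -(‖W x‖ ^ 2 + ⟪FluidPDE.convect v v x, W x⟫) ≤
        M ^ 2 * FluidPDE.frobeniusNormSq (fderiv ℝ v x) / 4 := by
      have h1 : -⟪FluidPDE.convect v v x, W x⟫ ≤ M * ‖fderiv ℝ v x‖ * ‖W x‖ :=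
        (neg_le_abs _).trans hc
      nlinarith [sq_nonneg (‖W x‖ - M * ‖fderiv ℝ v x‖ / 2), norm_nonneg (W x),
        mul_nonneg hM0 (norm_nonneg (fderiv ℝ v x))]
    have := mul_le_mul_of_nonneg_left key hν'.le
    calc -(ν⁻¹ * (‖W x‖ ^ 2 + ⟪FluidPDE.convect v v x, W x⟫ + ⟪gradient q x, W x⟫))
        = ν⁻¹ * (-(‖W x‖ ^ 2 + ⟪FluidPDE.convect v v x, W x⟫)) - ν⁻¹ * ⟪gradient q x, W x⟫ := by ring
      _ ≤ ν⁻¹ * (M ^ 2 * FluidPDE.frobeniusNormSq (fderiv ℝ v x) / 4) - ν⁻¹ * ⟪gradient q x, W x⟫ := by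
          gcongr
      _ = M ^ 2 / (4 * ν) * FluidPDE.frobeniusNormSq (fderiv ℝ v x) - ν⁻¹ * ⟪gradient q x, W x⟫ := by
          field_simp
  -- integrate
  have hL := integral_sum_inner_fderiv_fderiv_eq_neg_integral_inner_laplacian hv hW i1 i2 i3
  have ineg : Integrable (fun x => -⟪(Δ v) x, W x⟫) volume := iLap.neg
  have irhs : Integrable (fun x => M ^ 2 / (4 * ν) * FluidPDE.frobeniusNormSq (fderiv ℝ v x) -
      ν⁻¹ * ⟪gradient q x, W x⟫) volume := (ifrob.const_mul _).sub (igW.const_mul _)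
  have hmono : ∫ x, -⟪(Δ v) x, W x⟫ ≤ ∫ x, (M ^ 2 / (4 * ν) * FluidPDE.frobeniusNormSq (fderiv ℝ v x) -
      ν⁻¹ * ⟪gradient q x, W x⟫) := integral_mono ineg irhs fun x => hpt x
  have hrhs : ∫ x, (M ^ 2 / (4 * ν) * FluidPDE.frobeniusNormSq (fderiv ℝ v x) -
      ν⁻¹ * ⟪gradient q x, W x⟫) = M ^ 2 / (4 * ν) * ∫ x, FluidPDE.frobeniusNormSq (fderiv ℝ v x) := by
    rw [integral_sub (ifrob.const_mul _) (igW.const_mul _), integral_const_mul, integral_const_mul,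
      hpress, mul_zero, sub_zero]
  have hneg : ∫ x, -⟪(Δ v) x, W x⟫ = -∫ x, ⟪(Δ v) x, W x⟫ := integral_neg _
  rw [hL, ← hneg]
  exact hmono.trans hrhs.le

end Slice

/-! ### The enstrophy inequality on a slab -/

section Slab

/-- `ofReal |L|² ≤ 3 ‖L‖ₑ²` on `ℝ³`. [folklore] -/
theorem ofReal_frobeniusNormSq_le_three_mul_enorm_sq {F : Type*} [NormedAddCommGroup F] [InnerProductSpace ℝ F]
    [FiniteDimensional ℝ F] (L : EuclideanSpace ℝ (Fin 3) →L[ℝ] F) :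
    ENNReal.ofReal (FluidPDE.frobeniusNormSq L) ≤ 3 * ‖L‖ₑ ^ 2 := by
  calc ENNReal.ofReal (FluidPDE.frobeniusNormSq L) ≤ ENNReal.ofReal (3 * ‖L‖ ^ 2) :=
        ENNReal.ofReal_le_ofReal (frobeniusNormSq_le_three_mul L)
    _ = 3 * ‖L‖ₑ ^ 2 := by
        rw [ENNReal.ofReal_mul (by norm_num), ENNReal.ofReal_pow (norm_nonneg _), ofReal_norm]
        norm_num

/-- **The enstrophy inequality under an `L^∞` bound** (Serrin's criterion at the endpoint
`(p, q) = (2, ∞)`: Lemarié-Rieusset 2016, Thm. 11.2, (11.11) with `‖u‖²_∞ ≤ M²`, via (11.9)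
and Grönwall). Let `(u, p)` be a classical solution of the unforced Navier–Stokes system with
viscosity `ν > 0` on the closed slab `[0, T] × ℝ³` such that `u`, `∂ₜu` (the one-sided time
derivative within `[0, T]`) and `p` have all `L²` Sobolev norms bounded on `[0, T]` (Tao 2013,
Thm. 5.4 (iv); only the orders `≤ 2` for `u` and `≤ 1` for `∂ₜu`, `p` are used). If `|u| ≤ M` on `[0, s] × ℝ³`
for some `0 < s ≤ T` and `M > 0`, then
`∫ |∇u(s)|² ≤ exp (M² s / (2ν)) ∫ |∇u(0)|²`.
Proof: `G(t) = ∫ |∇u(t)|²` satisfies `G(b) - G(0) = ∫₀ᵇ 2∫ Σᵢ ⟪∂ᵢu, ∂ᵢ∂ₜu⟫` (pointwise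
`d/dt |∇u|² = 2Σᵢ⟪∂ᵢu, ∂ᵢ∂ₜu⟫`, then Fubini, all fields being `L^∞_t L²_x`), the integrand is at
most `(M²/(2ν)) G(t)` by `integral_sum_inner_fderiv_le_of_momentum`, and Grönwall's lemma in
integral form (`NS.bootstrap_gronwall_integral`) concludes. [cite: LemarieRieusset2016, Thm. 11.2 (11.11)] -/
theorem lintegral_frobeniusNormSq_fderiv_le_mul_exp {ν T : ℝ} (hν : 0 < ν) (hT : 0 < T)
    {u : ℝ → EuclideanSpace ℝ (Fin 3) → EuclideanSpace ℝ (Fin 3)}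
    {p : ℝ → EuclideanSpace ℝ (Fin 3) → ℝ} (hsol : FluidPDE.IsClassicalNSSolutionOn (Icc 0 T) ν 0 u p)
    (hu : HasBoundedSobolevNormsOn (Icc 0 T) u)
    (hut : HasBoundedSobolevNormsOn (Icc 0 T) (FluidPDE.timeDerivWithin (Icc 0 T) u))
    (hp : ∀ n : ℕ, ∃ C : ℝ≥0, ∀ t ∈ Icc 0 T, ∫⁻ x, ‖iteratedFDeriv ℝ n (p t) x‖ₑ ^ 2 ≤ C)
    {M s : ℝ} (hM0 : 0 < M) (hs : s ∈ Ioc 0 T) (hM : ∀ t ∈ Icc 0 s, ∀ x, ‖u t x‖ ≤ M) :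
    ∫⁻ x, ENNReal.ofReal (FluidPDE.frobeniusNormSq (fderiv ℝ (u s) x)) ≤
      ENNReal.ofReal (Real.exp (M ^ 2 * s / (2 * ν))) *
        ∫⁻ x, ENNReal.ofReal (FluidPDE.frobeniusNormSq (fderiv ℝ (u 0) x)) := by
  set e := EuclideanSpace.basisFun (Fin 3) ℝ with he
  have hU : UniqueDiffOn ℝ (Icc 0 T) := uniqueDiffOn_Icc hT
  set W : ℝ → EuclideanSpace ℝ (Fin 3) → EuclideanSpace ℝ (Fin 3) :=
    FluidPDE.timeDerivWithin (Icc 0 T) u with hW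
  have hWsm : FluidPDE.IsSmoothSpaceTimeOn (Icc 0 T) W := hsol.smooth_velocity.timeDerivWithin hU
  -- joint continuity of `D(u t)(x)` and `D(W t)(x)`
  have cDu : ContinuousOn (fun z : ℝ × EuclideanSpace ℝ (Fin 3) => fderiv ℝ (u z.1) z.2)
      (Icc 0 T ×ˢ univ) := hsol.smooth_velocity.continuousOn_fderiv_slice hU
  have cDW : ContinuousOn (fun z : ℝ × EuclideanSpace ℝ (Fin 3) => fderiv ℝ (W z.1) z.2)
      (Icc 0 T ×ˢ univ) := hWsm.continuousOn_fderiv_slice hU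
  -- the density `g t x = Σᵢ ⟪∂ᵢu, ∂ᵢW⟫` and the enstrophy `G t = ∫ |∇u(t)|²`
  set g : ℝ → EuclideanSpace ℝ (Fin 3) → ℝ := fun t x =>
    ∑ i, ⟪fderiv ℝ (u t) x (e i), fderiv ℝ (W t) x (e i)⟫ with hg
  set G : ℝ → ℝ := fun t => ∫ x, FluidPDE.frobeniusNormSq (fderiv ℝ (u t) x) with hG
  have cg : ContinuousOn (uncurry g) (Icc 0 T ×ˢ univ) := by
    refine continuousOn_finsetSum _ fun i _ => ContinuousOn.inner ?_ ?_
    · exact cDu.clm_apply continuousOn_const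
    · exact cDW.clm_apply continuousOn_const
  have cfrob : ContinuousOn (fun z : ℝ × EuclideanSpace ℝ (Fin 3) =>
      FluidPDE.frobeniusNormSq (fderiv ℝ (u z.1) z.2)) (Icc 0 T ×ˢ univ) :=
    continuous_frobeniusNormSq_clm.comp_continuousOn cDu
  -- uniform `L²` bounds
  obtain ⟨C₁, hC₁⟩ := hu 1
  obtain ⟨C₂, hC₂⟩ := hut 1
  have hfrob_le : ∀ t ∈ Icc 0 T,
      ∫⁻ x, ENNReal.ofReal (FluidPDE.frobeniusNormSq (fderiv ℝ (u t) x)) ≤ 3 * C₁ := by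
    intro t ht
    calc ∫⁻ x, ENNReal.ofReal (FluidPDE.frobeniusNormSq (fderiv ℝ (u t) x))
        ≤ ∫⁻ x, 3 * ‖iteratedFDeriv ℝ 1 (u t) x‖ₑ ^ 2 := lintegral_mono fun x => by
          rw [← ofReal_norm, norm_iteratedFDeriv_one, ofReal_norm]
          exact ofReal_frobeniusNormSq_le_three_mul_enorm_sq _
      _ = 3 * ∫⁻ x, ‖iteratedFDeriv ℝ 1 (u t) x‖ₑ ^ 2 := lintegral_const_mul' _ _ (by norm_num)
      _ ≤ 3 * C₁ := by gcongr; exact hC₁ t ht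
  have hfrob_lt : ∀ t ∈ Icc 0 T,
      ∫⁻ x, ENNReal.ofReal (FluidPDE.frobeniusNormSq (fderiv ℝ (u t) x)) < ⊤ := fun t ht =>
    lt_of_le_of_lt (hfrob_le t ht) (ENNReal.mul_lt_top (by norm_num) ENNReal.coe_lt_top)
  have hDu_lt : ∀ t ∈ Icc 0 T, ∫⁻ x, ‖fderiv ℝ (u t) x‖ₑ ^ 2 < ⊤ := fun t ht =>
    lintegral_enorm_sq_fderiv_lt_top (hfrob_lt t ht)
  have hDW_le : ∀ t ∈ Icc 0 T, ∫⁻ x, ‖fderiv ℝ (W t) x‖ₑ ^ 2 ≤ C₂ := fun t ht => by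
    calc ∫⁻ x, ‖fderiv ℝ (W t) x‖ₑ ^ 2 = ∫⁻ x, ‖iteratedFDeriv ℝ 1 (W t) x‖ₑ ^ 2 :=
          lintegral_congr fun x => by
            rw [← ofReal_norm, ← norm_iteratedFDeriv_one, ofReal_norm]
      _ ≤ C₂ := hC₂ t ht
  -- integrability of the slices of `|∇u|²` and the identity `ofReal (G t) = ∫⁻ ofReal |∇u|²`
  have ifrob : ∀ t ∈ Icc 0 T, Integrable (fun x => FluidPDE.frobeniusNormSq (fderiv ℝ (u t) x)) volume :=
    fun t ht => integrable_of_continuous_of_nonneg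
      (FluidPDE.continuous_frobeniusNormSq_fderiv (hsol.contDiff_velocity ht) (by simp))
      (fun x => FluidPDE.frobeniusNormSq_nonneg _) (hfrob_lt t ht)
  have hGeq : ∀ t ∈ Icc 0 T, ENNReal.ofReal (G t) =
      ∫⁻ x, ENNReal.ofReal (FluidPDE.frobeniusNormSq (fderiv ℝ (u t) x)) := fun t ht =>
    ofReal_integral_eq_lintegral_ofReal (ifrob t ht)
      (Eventually.of_forall fun x => FluidPDE.frobeniusNormSq_nonneg _)
  have hG0 : ∀ t, 0 ≤ G t := fun t => integral_nonneg fun x => FluidPDE.frobeniusNormSq_nonneg _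
  -- pointwise bound `|g| ≤ (3/2)(‖Du‖² + ‖DW‖²)` and integrability of `g` on `(0, T) × ℝ³`
  have hgle : ∀ t x, ‖g t x‖ ≤ (3 / 2) * (‖fderiv ℝ (u t) x‖ ^ 2 + ‖fderiv ℝ (W t) x‖ ^ 2) := by
    intro t x
    have h1 : ∀ i, ‖⟪fderiv ℝ (u t) x (e i), fderiv ℝ (W t) x (e i)⟫‖ ≤
        ‖fderiv ℝ (u t) x‖ * ‖fderiv ℝ (W t) x‖ := fun i =>
      (norm_inner_le_norm (𝕜 := ℝ) _ _).trans (mul_le_mul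
        (by simpa [he] using (fderiv ℝ (u t) x).le_opNorm (e i))
        (by simpa [he] using (fderiv ℝ (W t) x).le_opNorm (e i)) (norm_nonneg _) (norm_nonneg _))
    calc ‖g t x‖ ≤ ∑ i, ‖⟪fderiv ℝ (u t) x (e i), fderiv ℝ (W t) x (e i)⟫‖ := norm_sum_le _ _
      _ ≤ ∑ _i : Fin 3, ‖fderiv ℝ (u t) x‖ * ‖fderiv ℝ (W t) x‖ := Finset.sum_le_sum fun i _ => h1 i
      _ = 3 * (‖fderiv ℝ (u t) x‖ * ‖fderiv ℝ (W t) x‖) := by simp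
      _ ≤ (3 / 2) * (‖fderiv ℝ (u t) x‖ ^ 2 + ‖fderiv ℝ (W t) x‖ ^ 2) := by
          nlinarith [sq_nonneg (‖fderiv ℝ (u t) x‖ - ‖fderiv ℝ (W t) x‖)]
  have hg_lint : ∀ t ∈ Icc 0 T, ∫⁻ x, ‖g t x‖ₑ ≤ (3 / 2 : ℝ≥0∞) * (3 * C₁ + C₂) := by
    intro t ht
    have h32 : (3 / 2 : ℝ≥0∞) = ENNReal.ofReal (3 / 2) := by
      rw [ENNReal.ofReal_div_of_pos (by norm_num), ENNReal.ofReal_ofNat, ENNReal.ofReal_ofNat]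
    have hpt : ∀ x, ‖g t x‖ₑ ≤ (3 / 2 : ℝ≥0∞) * (‖fderiv ℝ (u t) x‖ₑ ^ 2 + ‖fderiv ℝ (W t) x‖ₑ ^ 2) := by
      intro x
      have hR : (3 / 2 : ℝ≥0∞) * (‖fderiv ℝ (u t) x‖ₑ ^ 2 + ‖fderiv ℝ (W t) x‖ₑ ^ 2) =
          ENNReal.ofReal ((3 / 2) * (‖fderiv ℝ (u t) x‖ ^ 2 + ‖fderiv ℝ (W t) x‖ ^ 2)) := by
        rw [ENNReal.ofReal_mul (by norm_num), ENNReal.ofReal_add (sq_nonneg _) (sq_nonneg _),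
          ENNReal.ofReal_pow (norm_nonneg _), ENNReal.ofReal_pow (norm_nonneg _), ofReal_norm,
          ofReal_norm, h32]
      rw [hR, ← ofReal_norm]
      exact ENNReal.ofReal_le_ofReal (hgle t x)
    calc ∫⁻ x, ‖g t x‖ₑ ≤ ∫⁻ x, (3 / 2 : ℝ≥0∞) * (‖fderiv ℝ (u t) x‖ₑ ^ 2 + ‖fderiv ℝ (W t) x‖ₑ ^ 2) :=
          lintegral_mono hpt
      _ = (3 / 2 : ℝ≥0∞) * ((∫⁻ x, ‖fderiv ℝ (u t) x‖ₑ ^ 2) + ∫⁻ x, ‖fderiv ℝ (W t) x‖ₑ ^ 2) := by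
          rw [lintegral_const_mul' _ _ (ENNReal.div_ne_top (by simp) (by simp)), lintegral_add_left']
          exact ((hsol.contDiff_velocity ht).continuous_fderiv (by simp)).aemeasurable.enorm.pow_const _
      _ ≤ (3 / 2 : ℝ≥0∞) * (3 * C₁ + C₂) := by
          gcongr
          · calc ∫⁻ x, ‖fderiv ℝ (u t) x‖ₑ ^ 2
                ≤ ∫⁻ x, ENNReal.ofReal (FluidPDE.frobeniusNormSq (fderiv ℝ (u t) x)) :=
                  lintegral_mono fun _ => enorm_sq_fderiv_le_ofReal_frobeniusNormSq _
              _ ≤ 3 * C₁ := hfrob_le t ht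
          · exact hDW_le t ht
  have h32ne : (3 / 2 : ℝ≥0∞) ≠ ⊤ := ENNReal.div_ne_top (by simp) (by simp)
  have hKfin : (3 / 2 : ℝ≥0∞) * (3 * C₁ + C₂) ≠ ⊤ :=
    ENNReal.mul_ne_top h32ne
      (ENNReal.add_ne_top.2 ⟨ENNReal.mul_ne_top (by norm_num) ENNReal.coe_ne_top, ENNReal.coe_ne_top⟩)
  have hg_int : ∀ b ∈ Ioc 0 T, Integrable (uncurry g)
      (((volume : Measure ℝ).restrict (Ioo 0 b)).prod volume) := by
    intro b hb
    refine FluidPDE.integrable_prod_of_continuousOn_of_lintegral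
      (cg.mono (prod_mono (Icc_subset_Icc le_rfl hb.2) Subset.rfl)) ?_
    calc ∫⁻ t in Ioo 0 b, ∫⁻ x, ‖uncurry g (t, x)‖ₑ
        ≤ ∫⁻ _ in Ioo 0 b, (3 / 2 : ℝ≥0∞) * (3 * C₁ + C₂) :=
          setLIntegral_mono' measurableSet_Ioo fun t ht =>
            hg_lint t ⟨ht.1.le, ht.2.le.trans hb.2⟩
      _ < ⊤ := by
          rw [setLIntegral_const]
          exact ENNReal.mul_lt_top hKfin.lt_top (by simp)
  -- the time derivative of `|∇u(t, x)|²` at interior times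
  have hderiv : ∀ t ∈ Ioo 0 T, ∀ x, HasDerivAt (fun τ => FluidPDE.frobeniusNormSq (fderiv ℝ (u τ) x))
      (2 * g t x) t := fun t ht x =>
    hasDerivAt_frobeniusNormSq (hsol.smooth_velocity.hasDerivAt_fderiv_slice_timeDerivWithin
      isOpen_Ioo Ioo_subset_Icc_self ht x)
  -- FTC in `t` for each `x`, on `[0, b]`
  have hFTC : ∀ b ∈ Ioc 0 T, ∀ x, ∫ t in (0 : ℝ)..b, 2 * g t x =
      FluidPDE.frobeniusNormSq (fderiv ℝ (u b) x) - FluidPDE.frobeniusNormSq (fderiv ℝ (u 0) x) := by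
    intro b hb x
    have hsub : Icc 0 b ⊆ Icc 0 T := Icc_subset_Icc le_rfl hb.2
    have hc : ContinuousOn (fun τ => ((τ, x) : ℝ × EuclideanSpace ℝ (Fin 3))) (Icc 0 b) :=
      (continuous_id.prodMk continuous_const).continuousOn
    have hmaps : MapsTo (fun τ => ((τ, x) : ℝ × EuclideanSpace ℝ (Fin 3))) (Icc 0 b)
        (Icc 0 T ×ˢ univ) := fun τ hτ => mk_mem_prod (hsub hτ) (mem_univ x)
    have hcont : ContinuousOn (fun τ => FluidPDE.frobeniusNormSq (fderiv ℝ (u τ) x)) (Icc 0 b) :=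
      (cfrob.comp hc hmaps).congr fun τ _ => rfl
    have hcg : ContinuousOn (fun τ => g τ x) (Icc 0 b) := (cg.comp hc hmaps).congr fun τ _ => rfl
    have hcont' : ContinuousOn (fun τ => 2 * g τ x) (Icc 0 b) := continuousOn_const.mul hcg
    exact intervalIntegral.integral_eq_sub_of_hasDerivAt_of_le
      (f := fun τ => FluidPDE.frobeniusNormSq (fderiv ℝ (u τ) x)) (f' := fun τ => 2 * g τ x) hb.1.le
      hcont (fun t ht => hderiv t ⟨ht.1, ht.2.trans_le hb.2⟩ x)
      (hcont'.intervalIntegrable_of_Icc hb.1.le)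
  -- Fubini: `G b - G 0 = ∫₀ᵇ ∫ 2 g`
  set φ : ℝ → ℝ := fun t => ∫ x, 2 * g t x with hφ
  have hφ_int : IntegrableOn φ (Ioo 0 T) volume :=
    ((hg_int T ⟨hT, le_rfl⟩).const_mul 2).integral_prod_left
  have hGb : ∀ b ∈ Ioc 0 T, G b = G 0 + ∫ t in (0 : ℝ)..b, φ t := by
    intro b hb
    have hI := (hg_int b hb).const_mul 2
    have hswap := integral_integral_swap (μ := (volume : Measure ℝ).restrict (Ioo 0 b))
      (ν := (volume : Measure (EuclideanSpace ℝ (Fin 3)))) (f := fun t x => 2 * g t x) hI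
    -- `∫ x, ∫ t in 0..b, 2 g = ∫ x, (frob b - frob 0) = G b - G 0`
    have hx : ∫ x, ∫ t in Ioo 0 b, 2 * g t x = G b - G 0 := by
      have : (fun x => ∫ t in Ioo 0 b, 2 * g t x) = fun x =>
          FluidPDE.frobeniusNormSq (fderiv ℝ (u b) x) - FluidPDE.frobeniusNormSq (fderiv ℝ (u 0) x) := by
        funext x
        rw [← hFTC b hb x, intervalIntegral.integral_of_le hb.1.le, integral_Ioc_eq_integral_Ioo]
      rw [this, integral_sub (ifrob b ⟨hb.1.le, hb.2⟩) (ifrob 0 ⟨le_rfl, hT.le⟩)]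
    rw [intervalIntegral.integral_of_le hb.1.le, integral_Ioc_eq_integral_Ioo, hφ]
    simp only
    rw [hswap, hx]
    ring
  -- continuity of `G` on `[0, T]`
  have hGcont : ContinuousOn G (Icc 0 T) := by
    have hprim : ContinuousOn (fun b => ∫ t in (0 : ℝ)..b, φ t) (Icc 0 T) := by
      have h := intervalIntegral.continuousOn_primitive_interval (μ := volume) (f := φ) (a := 0)
        (b := T) (by
          rw [uIcc_of_le hT.le]
          exact (hφ_int.congr_set_ae Ioo_ae_eq_Icc.symm))
      rwa [uIcc_of_le hT.le] at h
    have heq : ∀ b ∈ Icc 0 T, G b = G 0 + ∫ t in (0 : ℝ)..b, φ t := by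
      intro b hb
      rcases eq_or_lt_of_le hb.1 with h | h
      · rw [← h]; simp
      · exact hGb b ⟨h, hb.2⟩
    exact (continuousOn_const.add hprim).congr heq
  -- the differential inequality `φ ≤ (M²/(2ν)) G` on `(0, s)`
  have hφle : ∀ t ∈ Ioo 0 s, φ t ≤ M ^ 2 / (2 * ν) * G t := by
    intro t ht
    have htT : t ∈ Ioo 0 T := ⟨ht.1, ht.2.trans_le hs.2⟩
    have htI : t ∈ Icc 0 T := Ioo_subset_Icc_self htT
    obtain ⟨C₀, hC₀⟩ := hut 0
    obtain ⟨D₂, hD₂⟩ := hu 2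
    obtain ⟨P₀, hP₀⟩ := hp 0
    obtain ⟨P₁, hP₁⟩ := hp 1
    have hzero : ∀ {f : EuclideanSpace ℝ (Fin 3) → EuclideanSpace ℝ (Fin 3)} {C : ℝ≥0},
        (∫⁻ x, ‖iteratedFDeriv ℝ 0 f x‖ₑ ^ 2 ≤ C) → ∫⁻ x, ‖f x‖ₑ ^ 2 < ⊤ := by
      intro f C h
      refine lt_of_le_of_lt ((le_of_eq (lintegral_congr fun x => ?_)).trans h) ENNReal.coe_lt_top
      rw [← ofReal_norm, ← ofReal_norm, norm_iteratedFDeriv_zero]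
    have hzero' : ∀ {f : EuclideanSpace ℝ (Fin 3) → ℝ} {C : ℝ≥0},
        (∫⁻ x, ‖iteratedFDeriv ℝ 0 f x‖ₑ ^ 2 ≤ C) → ∫⁻ x, ‖f x‖ₑ ^ 2 < ⊤ := by
      intro f C h
      refine lt_of_le_of_lt ((le_of_eq (lintegral_congr fun x => ?_)).trans h) ENNReal.coe_lt_top
      rw [← ofReal_norm, ← ofReal_norm, norm_iteratedFDeriv_zero]
    have hmom : ∀ x, W t x + FluidPDE.convect (u t) (u t) x = ν • (Δ (u t)) x - gradient (p t) x := by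
      intro x
      have h := hsol.momentum t htI x
      simpa [hW] using h
    have hslice := integral_sum_inner_fderiv_le_of_momentum hν
      ((hsol.contDiff_velocity htI).of_le (by norm_cast))
      ((hWsm.contDiff_slice htI).of_le (by norm_cast))
      ((hsol.contDiff_pressure htI).of_le (by norm_cast)) hmom
      (isDivFree_timeDerivWithin hsol.smooth_velocity hsol.divFree htT) hM0.le
      (fun x => hM t ⟨ht.1.le, ht.2.le⟩ x) (hfrob_lt t htI)
      ((hD₂ t htI).trans_lt ENNReal.coe_lt_top)
      (hzero (hC₀ t htI))
      ((hC₂ t htI).trans_lt ENNReal.coe_lt_top)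
      (hzero' (hP₀ t htI))
      ((hP₁ t htI).trans_lt ENNReal.coe_lt_top)
    have h2 : φ t = 2 * ∫ x, g t x := by
      rw [hφ]
      exact integral_const_mul _ _
    rw [h2]
    have : 2 * (M ^ 2 / (4 * ν) * ∫ x, FluidPDE.frobeniusNormSq (fderiv ℝ (u t) x)) =
        M ^ 2 / (2 * ν) * G t := by
      rw [hG]; ring
    rw [← this]
    exact mul_le_mul_of_nonneg_left hslice (by norm_num)
  -- Grönwall
  set κ : ℝ := M ^ 2 / (2 * ν) with hκ
  have hκpos : 0 < κ := by positivity
  have hφ_ii : ∀ t ∈ Icc 0 s, IntervalIntegrable φ volume 0 t := fun t ht =>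
    (intervalIntegrable_iff_integrableOn_Ioo_of_le ht.1).2
      (hφ_int.mono_set (Ioo_subset_Ioo le_rfl (ht.2.trans hs.2)))
  have hG_ii : ∀ t ∈ Icc 0 s, IntervalIntegrable (fun τ => κ * G τ + 0) volume 0 t := fun t ht =>
    ((continuousOn_const.mul (hGcont.mono (Icc_subset_Icc le_rfl (ht.2.trans hs.2)))).add
      continuousOn_const).intervalIntegrable_of_Icc ht.1
  have hineq : ∀ t ∈ Icc 0 s, (∀ τ ∈ Icc 0 t, G τ ≤ Real.exp (κ * s) * G 0 + 1) →
      G t ≤ G 0 + ∫ τ in (0 : ℝ)..t, (κ * G τ + 0) := by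
    intro t ht _
    rcases eq_or_lt_of_le ht.1 with h | h
    · rw [← h]; simp
    rw [hGb t ⟨h, ht.2.trans hs.2⟩]
    gcongr
    refine intervalIntegral.integral_mono_ae_restrict ht.1 (hφ_ii t ht) (hG_ii t ht) ?_
    have hre : (volume : Measure ℝ).restrict (Icc 0 t) = volume.restrict (Ioo 0 t) :=
      Measure.restrict_congr_set Ioo_ae_eq_Icc.symm
    rw [Filter.EventuallyLE, hre, ae_restrict_iff' measurableSet_Ioo]
    exact Eventually.of_forall fun τ hτ => by
      simpa using hφle τ ⟨hτ.1, hτ.2.trans_le ht.2⟩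
  have hgron := bootstrap_gronwall_integral (B := Real.exp (κ * s) * G 0 + 1) hs.1 hκpos
    (hGcont.mono (Icc_subset_Icc le_rfl hs.2)) continuousOn_const (fun _ _ => le_rfl) (hG0 0)
    hineq (by simp)
  have hfinal : G s ≤ Real.exp (κ * s) * G 0 := by
    simpa using hgron s ⟨hs.1.le, le_rfl⟩
  -- back to lower integrals
  rw [← hGeq s ⟨hs.1.le, hs.2⟩, ← hGeq 0 ⟨le_rfl, hT.le⟩, ← ENNReal.ofReal_mul (Real.exp_nonneg _)]
  refine ENNReal.ofReal_le_ofReal (hfinal.trans_eq ?_)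
  rw [hκ]
  ring_nf

end Slab

end Literature.Analysis.FluidPDE

end
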